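import Literature.MathematicalPhysics.QuantumFieldTheory.Balaban1983to89.B9Eq387QuadraticPartitionIMS

/-!
# `Balaban1983to89.B9Eq387IMSPerturbationLetters` — T. Bałaban, *Propagators for lattice gauge theories in a background field*, Commun. Math. Phys.
# **99** (1985) 389–434 [Balaban1985BackgroundPropagators] p. 408 («Σ_□ h²_□ = 1»), (3.87)–(3.89) p. 409, (3.101)–(3.103) p. 414: **THE IMS LETTERS OF A
# BOUNDED PERTURBATION** — for two symmetric quadratic partitions `Σ_j (χ_S^j)² = 1` on `S`, `Σ_j (χ_E^j)² = 1` on `E` (as CLMs) and ANY bounded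
# `E′ : S → E`: the PINCHING bound `‖Σ_j χ_E^jE′χ_S^j‖ ≤ ‖E′‖`, the first-order square `Σ_j ‖χ_E^jE′x − E′χ_S^jx‖² ≤ 4‖E′‖²‖x‖²`, the double-commutator
# sum `‖Σ_j ad_j(ad_jE′)x‖ ≤ 4‖E′‖‖x‖`, the product `≤ 4‖E′‖²‖x‖²` — NO cutoff smoothness, NO `1∕M`: small ONLY through `‖E′‖` —, and the composition
# `T = T₀ + E′` (`a ≤ 2a₀ + 8‖E′‖²`, `tk ≤ (t₀ + ‖E′‖)(k₀ + 4‖E′‖)` for a BOUNDED `t₀`) — route R2′ STEP B8′ (S-P7 «IMS assembly»): the dress that carries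
# kernel 7's third local letter `T₃ = √a·Q_U` from the flat background (`B9Eq387IMSAveragingLettersLattice`) to a small one through the tree's `θ_Q`-letter
# `‖Q(U) − Q(1)‖ ≤ θ_Q` (`B9Eq315QLipschitzL2.norm_QtorusW_sub_flat_le_local`)

statement-level skeleton of published theorems with citation tags; proofs where landed; nothing here is a claim about the Yang–Mills mass gap

CITATION HEADER (lean-in-tree rule).  Audit cell `pub-balaban`, sub-cell `t4`, BINDER row NE9; filed by NE9 formalisation-swarm LEAF PROVER 01
(`b2b-balaban-t4-ne9-formalise-leaf-01`, gen 82), the lineage of the IMS files `B9Eq387QuadraticPartitionIMS` (the two-space IMS identity, imported) ∕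
`B9Eq387IMSAssembly` (kernel 7's port) ∕ `B9Eq387IMSLocalLettersLattice` ∕ `B9Eq387IMSAveragingLettersLattice`.  Abstract (Mathlib + the parent only); no
lattice object occurs.  Sources READ by this seat in the held text `paper:balaban1985-cmp99-background-propagators` (journal page = PDF page + 388): p. 408,
p. 409 (3.87)–(3.89), p. 414 (3.101)–(3.103).

THE PRINT (verbatim).  p. 408: *«We take the partition of unity {h_□} defined at the end of Sect. A in [4]. We have Σ_{□∈𝒟} h²_□ = 1.»*; p. 414 l. 1–3: the
commutators with `h` *«are first order differential operators with coefficients determined by derivatives of the function h. They are of the order O(M⁻¹),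
or O(M⁻²), if considered on a proper scale.»*  Print localises `Δ_a(U)` with this partition through parametrices ((3.87)) and random-walk expansions; the
IMS bookkeeping is the ROUTE's device (kernel 7); the perturbation step below is the route's way to carry a letter known at `U = 1` to a small background
WITHOUT re-deriving its commutators — nothing of [B9] is asserted.

WHY (route R2′ STEP B8′, S-P7; instance ledger `t4/ROUTES-NE9.md` v13.34 rows L5∕L6∕L7, `i = 3`).  `B9Eq387IMSAveragingLettersLattice` gives the `T₃` letters
for the FLAT vector averaging `Q(1)` (exact Leibniz rule (3.102)); the chain runs at a small background `U`, where `Q(U) = Q(1) + E′` with `‖E′‖ ≤ θ_Q`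
(the tree's `B9Eq315QLipschitzL2.norm_QtorusW_sub_flat_le_local`; no kernel formula for `Q(U)` is in the tree — `linQcov` is a derivative).  The IMS letters
of `E′` need NO locality: they are quadratic ∕ linear in `‖E′‖` for ANY symmetric quadratic partition (the pinching bound is the only non-trivial step), so the
(dn) row of `ims_assembly_strong` for `T₃ = √a·Q(U)` follows from the flat row plus `θ_Q` — with the `1∕M²`-smallness coming from `Q(1)` and the
`θ_Q`-smallness from the window.  This file is the abstract half; the lattice instance is a sequel.

WHAT IS PROVED (sorry-free; proof lane — no `def`, no `Prop` placeholder; [folklore] Cauchy–Schwarz and finite sums; nothing of [B9] asserted).  Setting: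
`RCLike 𝕜`, inner-product spaces `S`, `E`, a finite family of CLMs `χ_S^j`, `χ_E^j` with `Σ_j χ_S^j(χ_S^jx) = x`, `Σ_j χ_E^j(χ_E^jy) = y` and symmetry
`⟪χ^ju, u′⟫ = ⟪u, χ^ju′⟫` (hypotheses `hS`, `hSsa`, `hE`, `hEsa` — (D) `B9Eq387IMSLocalLettersLattice` §1 discharges them for pointwise real multipliers).
* §1 **`norm_sum_chi_apply_chi_le`** (PINCHING: `‖Σ_j χ_E^j(T(χ_S^jx))‖ ≤ ‖T‖·‖x‖` — duality, `Finset.sum_mul_sq_le_sq_mul_sq`, the parent's `sum_norm_sq_chi_apply`).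
* §2 **`sum_norm_sq_comm_le`** (`Σ_j ‖χ_E^j(E′x) − E′(χ_S^jx)‖² ≤ 4‖E′‖²‖x‖²`), `sum_comm_comm_eq` (the family's double-commutator sum of `E′` `= 2E′x −
  2Σ_jχ_E^jE′χ_S^jx`), **`norm_sum_comm_comm_le`** (`≤ 4‖E′‖‖x‖`), `norm_mul_norm_sum_comm_comm_le` (`≤ 4‖E′‖²‖x‖²`) — in (D) §2's `hAD`∕`hTK` shapes.
* §3 COMPOSITION: **`sum_norm_sq_comm_add_le`** (`T₀` with `a₀` ⟹ `T₀ + E′` with `2a₀ + 8‖E′‖²`), `sum_comm_comm_add_eq` (additivity of the double-commutator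
  expression in the operator), **`norm_mul_norm_sum_comm_comm_add_le`** (`‖T₀x‖ ≤ t₀‖x‖`, `‖Σ_j ad_j(ad_jT₀)x‖ ≤ k₀‖x‖` ⟹ product `≤ (t₀ + ‖E′‖)(k₀ + 4‖E′‖)‖x‖²`).
* §4 non-vacuity (`χ = id`, one member, `E′ = 0`).
HONEST SCOPE.  Abstract bookkeeping; the smallness of `‖E′‖` (the chain's `θ_Q`, which carries its own `L`- and window-dependence) is NOT produced here and
the product composition is useful only for a BOUNDED unperturbed letter (`T₃`; for `T₁, T₂ = O(η⁻¹)` the exact letters of NE9 leaf-04 are the road);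
rows of ONE sub-step of a route step, NOT NE9 (cell pub-balaban: NE9 NOT PRINTED ∕ NOT PROVED; «NE9 ⇐ the named binders»; row WALLED ON A MODEL (O-NE9-1);
spine PROVED 0∕9; rung (B)+1 on a finite T⁴ — NOT infinite volume, NOT mass gap, NOT Clay; HONEST DEPENDENCY: continuum YM on T⁴ ⇐ BetaPertH ∧ nine spine
estimates (0/9 proved); BetaPertH ⇐ (D1) ∧ (D4) ∧ CAP+tail; G-an2-4 gates asym, D1 and NE2/3/4).  NEW file importing `B9Eq387QuadraticPartitionIMS` only;
nothing modified.  Net new unproved facts: 0.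
-/

noncomputable section

open scoped BigOperators InnerProductSpace ComplexConjugate
open Finset

namespace Literature.MathematicalPhysics.QuantumFieldTheory.Balaban1983to89.B9Eq387IMSPerturbationLetters

open B9Eq387QuadraticPartitionIMS (sum_norm_sq_chi_apply)

variable {𝕜 : Type*} [RCLike 𝕜] {S E : Type*} [NormedAddCommGroup S] [InnerProductSpace 𝕜 S] [NormedAddCommGroup E] [InnerProductSpace 𝕜 E]
  {J : Type*} (s : Finset J) (χS : J → S →L[𝕜] S) (χE : J → E →L[𝕜] E)
  (hS : ∀ x, ∑ j ∈ s, χS j (χS j x) = x) (hSsa : ∀ j (x x' : S), ⟪χS j x, x'⟫_𝕜 = ⟪x, χS j x'⟫_𝕜)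
  (hE : ∀ y, ∑ j ∈ s, χE j (χE j y) = y) (hEsa : ∀ j (y y' : E), ⟪χE j y, y'⟫_𝕜 = ⟪y, χE j y'⟫_𝕜)

/-! ## §1 The pinching bound `‖Σ_j χ_E^j E χ_S^j‖ ≤ ‖E‖` for two symmetric quadratic partitions -/

include hS hSsa hE hEsa in
/-- **PINCHING**: for symmetric quadratic partitions `Σ_j (χ_S^j)² = 1` on `S` and `Σ_j (χ_E^j)² = 1` on `E` and any bounded `T : S → E`,
`‖Σ_j χ_E^j T χ_S^j x‖ ≤ ‖T‖·‖x‖` — duality + Cauchy–Schwarz over `j` with `Σ_j‖χ_E^jv‖² = ‖v‖²`, `Σ_j‖χ_S^jx‖² = ‖x‖²`. [folklore] (IMS localisation)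
[cite: Balaban1985BackgroundPropagators, p.408, (3.87) p.409] -/
theorem norm_sum_chi_apply_chi_le (T : S →L[𝕜] E) (x : S) : ‖∑ j ∈ s, χE j (T (χS j x))‖ ≤ ‖T‖ * ‖x‖ := by
  set v : E := ∑ j ∈ s, χE j (T (χS j x)) with hv
  have hT0 : 0 ≤ ‖T‖ := norm_nonneg _
  -- `‖v‖² = Σ_j re⟪χ_E^j v, T χ_S^j x⟫ ≤ ‖T‖ Σ_j ‖χ_E^j v‖‖χ_S^j x‖ ≤ ‖T‖‖v‖‖x‖`
  have h1 : ‖v‖ ^ 2 = ∑ j ∈ s, RCLike.re ⟪χE j v, T (χS j x)⟫_𝕜 := by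
    rw [@norm_sq_eq_re_inner 𝕜, hv]
    conv_lhs => rw [inner_sum]
    rw [map_sum]
    exact Finset.sum_congr rfl fun j _ => by rw [← hv, hEsa]
  have h2 : ∑ j ∈ s, RCLike.re ⟪χE j v, T (χS j x)⟫_𝕜 ≤ ‖T‖ * ∑ j ∈ s, ‖χE j v‖ * ‖χS j x‖ := by
    rw [Finset.mul_sum]
    refine Finset.sum_le_sum fun j _ => (re_inner_le_norm _ _).trans ?_
    calc ‖χE j v‖ * ‖T (χS j x)‖ ≤ ‖χE j v‖ * (‖T‖ * ‖χS j x‖) := mul_le_mul_of_nonneg_left (T.le_opNorm _) (norm_nonneg _)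
      _ = ‖T‖ * (‖χE j v‖ * ‖χS j x‖) := by ring
  have h3 : (∑ j ∈ s, ‖χE j v‖ * ‖χS j x‖) ^ 2 ≤ ‖v‖ ^ 2 * ‖x‖ ^ 2 := by
    have h := Finset.sum_mul_sq_le_sq_mul_sq s (fun j => ‖χE j v‖) (fun j => ‖χS j x‖)
    rwa [sum_norm_sq_chi_apply s χE hE hEsa v, sum_norm_sq_chi_apply s χS hS hSsa x] at h
  have h4 : ∑ j ∈ s, ‖χE j v‖ * ‖χS j x‖ ≤ ‖v‖ * ‖x‖ := by
    have h0 : 0 ≤ ∑ j ∈ s, ‖χE j v‖ * ‖χS j x‖ := Finset.sum_nonneg fun j _ => by positivity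
    rw [← mul_pow] at h3
    exact (pow_le_pow_iff_left₀ h0 (by positivity) two_ne_zero).1 h3
  have h5 : ‖v‖ ^ 2 ≤ ‖T‖ * ‖x‖ * ‖v‖ := by
    calc ‖v‖ ^ 2 ≤ ‖T‖ * ∑ j ∈ s, ‖χE j v‖ * ‖χS j x‖ := h1.le.trans h2
      _ ≤ ‖T‖ * (‖v‖ * ‖x‖) := mul_le_mul_of_nonneg_left h4 hT0
      _ = ‖T‖ * ‖x‖ * ‖v‖ := by ring
  by_cases hv0 : ‖v‖ = 0
  · rw [hv0]; positivity
  · have hvp : 0 < ‖v‖ := lt_of_le_of_ne (norm_nonneg _) (Ne.symm hv0)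
    rw [pow_two] at h5
    exact le_of_mul_le_mul_right h5 hvp

/-! ## §2 The IMS letters of a bounded perturbation `E′`: `a_{E′} ≤ 4‖E′‖²`, `k_{E′} ≤ 4‖E′‖`, `t_{E′}k_{E′} ≤ 4‖E′‖²` — M-free, small with `‖E′‖` -/

include hS hSsa hE hEsa in
/-- **FIRST-ORDER SQUARE OF A BOUNDED PERTURBATION**: `Σ_j ‖χ_E^j(E′x) − E′(χ_S^jx)‖² ≤ 4‖E′‖²‖x‖²` — NO cutoff smoothness, NO `1∕M`: the letter is small
only through `‖E′‖` (at the chain: `E′ = Q(U) − Q(1)`, `‖E′‖ ≤ θ_Q`). [folklore] [cite: Balaban1985BackgroundPropagators, p.408, (3.101)–(3.103) p.414] -/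
theorem sum_norm_sq_comm_le (E' : S →L[𝕜] E) (x : S) : ∑ j ∈ s, ‖χE j (E' x) - E' (χS j x)‖ ^ 2 ≤ 4 * ‖E'‖ ^ 2 * ‖x‖ ^ 2 := by
  have h1 : ∀ j ∈ s, ‖χE j (E' x) - E' (χS j x)‖ ^ 2 ≤ 2 * ‖χE j (E' x)‖ ^ 2 + 2 * ‖E' (χS j x)‖ ^ 2 := fun j _ => by
    have h := norm_sub_le (χE j (E' x)) (E' (χS j x))
    nlinarith [norm_nonneg (χE j (E' x) - E' (χS j x)), norm_nonneg (χE j (E' x)), norm_nonneg (E' (χS j x)),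
      sq_nonneg (‖χE j (E' x)‖ - ‖E' (χS j x)‖)]
  have h2 : ∑ j ∈ s, ‖E' (χS j x)‖ ^ 2 ≤ ‖E'‖ ^ 2 * ‖x‖ ^ 2 := by
    calc ∑ j ∈ s, ‖E' (χS j x)‖ ^ 2 ≤ ∑ j ∈ s, (‖E'‖ * ‖χS j x‖) ^ 2 :=
          Finset.sum_le_sum fun j _ => pow_le_pow_left₀ (norm_nonneg _) (E'.le_opNorm _) 2
      _ = ‖E'‖ ^ 2 * ‖x‖ ^ 2 := by
          simp only [mul_pow, ← Finset.mul_sum, sum_norm_sq_chi_apply s χS hS hSsa x]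
  have h3 : ‖E' x‖ ^ 2 ≤ ‖E'‖ ^ 2 * ‖x‖ ^ 2 := by
    rw [← mul_pow]; exact pow_le_pow_left₀ (norm_nonneg _) (E'.le_opNorm _) 2
  calc ∑ j ∈ s, ‖χE j (E' x) - E' (χS j x)‖ ^ 2 ≤ ∑ j ∈ s, (2 * ‖χE j (E' x)‖ ^ 2 + 2 * ‖E' (χS j x)‖ ^ 2) := Finset.sum_le_sum h1
    _ = 2 * ‖E' x‖ ^ 2 + 2 * ∑ j ∈ s, ‖E' (χS j x)‖ ^ 2 := by
        rw [Finset.sum_add_distrib, ← Finset.mul_sum, ← Finset.mul_sum, sum_norm_sq_chi_apply s χE hE hEsa (E' x)]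
    _ ≤ 4 * ‖E'‖ ^ 2 * ‖x‖ ^ 2 := by nlinarith [h2, h3]

include hS hE in
/-- the family's double-commutator sum of a linear `E′` collapses: `Σ_j (χ_E^j(χ_E^jE′x − E′χ_S^jx) − (χ_E^jE′χ_S^jx − E′χ_S^jχ_S^jx)) = 2E′x − 2Σ_j χ_E^jE′χ_S^jx`.
[folklore] [cite: Balaban1985BackgroundPropagators, p.408] -/
theorem sum_comm_comm_eq (E' : S →L[𝕜] E) (x : S) :
    ∑ j ∈ s, ((χE j (χE j (E' x) - E' (χS j x))) - (χE j (E' (χS j x)) - E' (χS j (χS j x)))) =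
      (2 : 𝕜) • E' x - (2 : 𝕜) • ∑ j ∈ s, χE j (E' (χS j x)) := by
  have h1 : ∀ j ∈ s, (χE j (χE j (E' x) - E' (χS j x))) - (χE j (E' (χS j x)) - E' (χS j (χS j x))) =
      χE j (χE j (E' x)) + E' (χS j (χS j x)) - (2 : 𝕜) • χE j (E' (χS j x)) := fun j _ => by
    rw [map_sub, two_smul]; abel
  rw [Finset.sum_congr rfl h1, Finset.sum_sub_distrib, Finset.sum_add_distrib, hE, ← map_sum, hS, ← Finset.smul_sum, two_smul, two_smul]

include hS hSsa hE hEsa in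
/-- **DOUBLE-COMMUTATOR SUM OF A BOUNDED PERTURBATION**: `‖Σ_j (…)‖ ≤ 4‖E′‖‖x‖` (`2‖E′x‖ + 2‖Σ_jχ_E^jE′χ_S^jx‖`, the pinching §1). [folklore]
[cite: Balaban1985BackgroundPropagators, p.408, (3.101)–(3.103) p.414] -/
theorem norm_sum_comm_comm_le (E' : S →L[𝕜] E) (x : S) :
    ‖∑ j ∈ s, ((χE j (χE j (E' x) - E' (χS j x))) - (χE j (E' (χS j x)) - E' (χS j (χS j x))))‖ ≤ 4 * ‖E'‖ * ‖x‖ := by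
  rw [sum_comm_comm_eq s χS χE hS hE]
  have h2 : ‖(2 : 𝕜)‖ = 2 := RCLike.norm_two
  calc ‖(2 : 𝕜) • E' x - (2 : 𝕜) • ∑ j ∈ s, χE j (E' (χS j x))‖ ≤ ‖(2 : 𝕜) • E' x‖ + ‖(2 : 𝕜) • ∑ j ∈ s, χE j (E' (χS j x))‖ := norm_sub_le _ _
    _ = 2 * ‖E' x‖ + 2 * ‖∑ j ∈ s, χE j (E' (χS j x))‖ := by rw [norm_smul, norm_smul, h2]
    _ ≤ 2 * (‖E'‖ * ‖x‖) + 2 * (‖E'‖ * ‖x‖) := by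
        gcongr
        · exact E'.le_opNorm x
        · exact norm_sum_chi_apply_chi_le s χS χE hS hSsa hE hEsa E' x
    _ = 4 * ‖E'‖ * ‖x‖ := by ring

include hS hSsa hE hEsa in
/-- **THE PRODUCT LETTER OF A BOUNDED PERTURBATION**: `‖E′x‖·‖Σ_j (…)‖ ≤ 4‖E′‖²‖x‖²`. [folklore] [cite: Balaban1985BackgroundPropagators, p.408, (3.101)–(3.103) p.414] -/
theorem norm_mul_norm_sum_comm_comm_le (E' : S →L[𝕜] E) (x : S) :
    ‖E' x‖ * ‖∑ j ∈ s, ((χE j (χE j (E' x) - E' (χS j x))) - (χE j (E' (χS j x)) - E' (χS j (χS j x))))‖ ≤ 4 * ‖E'‖ ^ 2 * ‖x‖ ^ 2 := by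
  calc _ ≤ (‖E'‖ * ‖x‖) * (4 * ‖E'‖ * ‖x‖) :=
        mul_le_mul (E'.le_opNorm x) (norm_sum_comm_comm_le s χS χE hS hSsa hE hEsa E' x) (norm_nonneg _) (by positivity)
    _ = 4 * ‖E'‖ ^ 2 * ‖x‖ ^ 2 := by ring

/-! ## §3 Composition `T = T₀ + E′`: the letters of a localised operator survive a bounded perturbation -/

include hS hSsa hE hEsa in
/-- **FIRST-ORDER SQUARE OF `T₀ + E′`**: `Σ_j ‖ad_j(T₀ + E′)x‖² ≤ (2a₀ + 8‖E′‖²)‖x‖²` from `Σ_j ‖ad_jT₀x‖² ≤ a₀‖x‖²`. [folklore]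
[cite: Balaban1985BackgroundPropagators, p.408, (3.101)–(3.103) p.414] -/
theorem sum_norm_sq_comm_add_le (T₀ E' : S →L[𝕜] E) {a₀ : ℝ} (hAD : ∀ x, ∑ j ∈ s, ‖χE j (T₀ x) - T₀ (χS j x)‖ ^ 2 ≤ a₀ * ‖x‖ ^ 2) (x : S) :
    ∑ j ∈ s, ‖χE j ((T₀ + E') x) - (T₀ + E') (χS j x)‖ ^ 2 ≤ (2 * a₀ + 8 * ‖E'‖ ^ 2) * ‖x‖ ^ 2 := by
  have h1 : ∀ j ∈ s, ‖χE j ((T₀ + E') x) - (T₀ + E') (χS j x)‖ ^ 2 ≤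
      2 * ‖χE j (T₀ x) - T₀ (χS j x)‖ ^ 2 + 2 * ‖χE j (E' x) - E' (χS j x)‖ ^ 2 := fun j _ => by
    have he : χE j ((T₀ + E') x) - (T₀ + E') (χS j x) = (χE j (T₀ x) - T₀ (χS j x)) + (χE j (E' x) - E' (χS j x)) := by
      rw [add_apply, add_apply, map_add]; abel
    rw [he]
    have h := norm_add_le (χE j (T₀ x) - T₀ (χS j x)) (χE j (E' x) - E' (χS j x))
    nlinarith [norm_nonneg ((χE j (T₀ x) - T₀ (χS j x)) + (χE j (E' x) - E' (χS j x))), norm_nonneg (χE j (T₀ x) - T₀ (χS j x)),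
      norm_nonneg (χE j (E' x) - E' (χS j x)), sq_nonneg (‖χE j (T₀ x) - T₀ (χS j x)‖ - ‖χE j (E' x) - E' (χS j x)‖)]
  calc _ ≤ ∑ j ∈ s, (2 * ‖χE j (T₀ x) - T₀ (χS j x)‖ ^ 2 + 2 * ‖χE j (E' x) - E' (χS j x)‖ ^ 2) := Finset.sum_le_sum h1
    _ = 2 * ∑ j ∈ s, ‖χE j (T₀ x) - T₀ (χS j x)‖ ^ 2 + 2 * ∑ j ∈ s, ‖χE j (E' x) - E' (χS j x)‖ ^ 2 := by
        rw [Finset.sum_add_distrib, Finset.mul_sum, Finset.mul_sum]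
    _ ≤ 2 * (a₀ * ‖x‖ ^ 2) + 2 * (4 * ‖E'‖ ^ 2 * ‖x‖ ^ 2) := by
        gcongr
        · exact hAD x
        · exact sum_norm_sq_comm_le s χS χE hS hSsa hE hEsa E' x
    _ = (2 * a₀ + 8 * ‖E'‖ ^ 2) * ‖x‖ ^ 2 := by ring

omit [InnerProductSpace 𝕜 S] [InnerProductSpace 𝕜 E] in
/-- the family's double-commutator expression is ADDITIVE in the operator. [folklore] [cite: Balaban1985BackgroundPropagators, p.408] -/
theorem sum_comm_comm_add_eq [NormedSpace 𝕜 S] [NormedSpace 𝕜 E] (χS' : J → S →L[𝕜] S) (χE' : J → E →L[𝕜] E) (T₀ E' : S →L[𝕜] E) (x : S) :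
    ∑ j ∈ s, ((χE' j (χE' j ((T₀ + E') x) - (T₀ + E') (χS' j x))) - (χE' j ((T₀ + E') (χS' j x)) - (T₀ + E') (χS' j (χS' j x)))) =
      ∑ j ∈ s, ((χE' j (χE' j (T₀ x) - T₀ (χS' j x))) - (χE' j (T₀ (χS' j x)) - T₀ (χS' j (χS' j x)))) +
        ∑ j ∈ s, ((χE' j (χE' j (E' x) - E' (χS' j x))) - (χE' j (E' (χS' j x)) - E' (χS' j (χS' j x)))) := by
  rw [← Finset.sum_add_distrib]
  refine Finset.sum_congr rfl fun j _ => ?_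
  simp only [add_apply, map_add, map_sub]
  abel

include hS hSsa hE hEsa in
/-- **THE PRODUCT LETTER OF `T₀ + E′`**: from `‖T₀x‖ ≤ t₀‖x‖` and `‖Σ_j ad_j(ad_jT₀)x‖ ≤ k₀‖x‖`,
`‖(T₀ + E′)x‖·‖Σ_j ad_j(ad_j(T₀ + E′))x‖ ≤ (t₀ + ‖E′‖)(k₀ + 4‖E′‖)‖x‖²` — for a BOUNDED `t₀` (kernel 7's `T₃`; not for `T₁, T₂ = O(η⁻¹)`). [folklore]
[cite: Balaban1985BackgroundPropagators, p.408, (3.101)–(3.103) p.414] -/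
theorem norm_mul_norm_sum_comm_comm_add_le (T₀ E' : S →L[𝕜] E) {t₀ k₀ : ℝ} (ht₀ : 0 ≤ t₀) (hT : ∀ x, ‖T₀ x‖ ≤ t₀ * ‖x‖)
    (hK : ∀ x, ‖∑ j ∈ s, ((χE j (χE j (T₀ x) - T₀ (χS j x))) - (χE j (T₀ (χS j x)) - T₀ (χS j (χS j x))))‖ ≤ k₀ * ‖x‖) (x : S) :
    ‖(T₀ + E') x‖ * ‖∑ j ∈ s, ((χE j (χE j ((T₀ + E') x) - (T₀ + E') (χS j x))) -
        (χE j ((T₀ + E') (χS j x)) - (T₀ + E') (χS j (χS j x))))‖ ≤ (t₀ + ‖E'‖) * (k₀ + 4 * ‖E'‖) * ‖x‖ ^ 2 := by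
  have h1 : ‖(T₀ + E') x‖ ≤ (t₀ + ‖E'‖) * ‖x‖ := by
    rw [add_apply, add_mul]
    exact (norm_add_le _ _).trans (add_le_add (hT x) (E'.le_opNorm x))
  have h2 : ‖∑ j ∈ s, ((χE j (χE j ((T₀ + E') x) - (T₀ + E') (χS j x))) -
      (χE j ((T₀ + E') (χS j x)) - (T₀ + E') (χS j (χS j x))))‖ ≤ (k₀ + 4 * ‖E'‖) * ‖x‖ := by
    rw [sum_comm_comm_add_eq s χS χE T₀ E' x, add_mul]
    exact (norm_add_le _ _).trans (add_le_add (hK x) (norm_sum_comm_comm_le s χS χE hS hSsa hE hEsa E' x))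
  calc _ ≤ ((t₀ + ‖E'‖) * ‖x‖) * ((k₀ + 4 * ‖E'‖) * ‖x‖) := mul_le_mul h1 h2 (norm_nonneg _) (by positivity)
    _ = (t₀ + ‖E'‖) * (k₀ + 4 * ‖E'‖) * ‖x‖ ^ 2 := by ring

/-! ## §4 Non-vacuity: the trivial partition (one cutoff = identity) and `E′ = 0` -/

/-- With the one-member partition `χ = id` on both spaces and `E′ = 0` every letter above holds with equality `0 ≤ 0`-style; the hypotheses are jointly
satisfiable. [folklore] [cite: Balaban1985BackgroundPropagators, p.408] -/
example (x : S) : ∑ j ∈ ({()} : Finset Unit), ‖(fun _ => ContinuousLinearMap.id 𝕜 E) j ((0 : S →L[𝕜] E) x) -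
    (0 : S →L[𝕜] E) ((fun _ => ContinuousLinearMap.id 𝕜 S) j x)‖ ^ 2 ≤ 4 * ‖(0 : S →L[𝕜] E)‖ ^ 2 * ‖x‖ ^ 2 :=
  sum_norm_sq_comm_le {()} (fun _ => ContinuousLinearMap.id 𝕜 S) (fun _ => ContinuousLinearMap.id 𝕜 E) (fun x => by simp) (fun _ _ _ => rfl)
    (fun y => by simp) (fun _ _ _ => rfl) 0 x

end Literature.MathematicalPhysics.QuantumFieldTheory.Balaban1983to89.B9Eq387IMSPerturbationLetters

end
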